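import Mathlib
import HarnessLib
import Summits.ValiantsHypothesis.ValiantsHypothesis.Theorems.MonotoneRestorationOrbitRestorationLinearVolumeQPBlockDescent
import Summits.ValiantsHypothesis.ValiantsHypothesis.Theorems.MonotoneRestorationOrbitRestorationLinearVolumeQPSubThresholdDescent

/-!
# Route MonotoneRestoration — aside `OrbitCompressionQP` (stmt-ValiantsHypothesis-18332), line
# `expression_compression`: THE DEGREE WINDOW `deg ≤ n` — bipartite narrowness at level `n` IS low-degree
# matrix-symmetric one-sorted liftability to level `n + n`, SAME WIDTH

S1c / qp-descent (the open first half of the aside, `…StubOneIffDescent`, `…Lift`) asks whether a MATRIX-symmetric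
polynomial in the ONE-SORTED narrow span `U_w(n)` lies in the BIPARTITE narrow span `W_{w'}(n)`.  Known: yes with
`w' = w` below the injective threshold `2 · deg ≤ n` (`SubThresholdDescent.subThreshold_descent`, p827466); yes with
`w' = w` ONE LEVEL DOWN in every degree (`BlockDescent.block_descent_span`, p829907).  Putting the two together
gives an EXACT description of `W_w(n)` in the first window above the threshold, with NO width loss:

  ★ `mem_narrowSpan_iff_lowDegree_lift` : for every `p` on the `n × n` matrix with `deg p ≤ n` and every
    off-diagonal block substitution `φ` (level `n + n → n`),
      `p ∈ W_w(n)`  ⟺  `p = φ(P)` for some MATRIX-symmetric `P ∈ U_w(n + n)` with `deg P ≤ n`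
    (⟸: `P` is below the threshold of level `n + n`, so `P ∈ W_w(n+n)` by sub-threshold descent, and block
    descent reads it one level down; ⟹: lift the bipartite expansion generator by generator,
    `hom_{E,n} = φ(N_E⁻¹ • hom_{E,n+n})`, degree by degree — `exists_graded_lift`, `exists_lowDegree_lift`).

So descent in the window `n/2 < deg p ≤ n` is EXACTLY the existence of a degree-preserving matrix-symmetric lift of
`p` into the one-sorted narrow span one level up (`descentWindow_iff_lift`), and iterating (towers of lifts to
levels `2n, 4n, …`, only the top one needing the degree bound, block descent bringing bipartite narrowness down
unconditionally — `mem_narrowSpan_of_lift_tower₂` for two storeys) covers every degree.  No symmetry hypothesis is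
needed on `p` for ⟸ beyond that of the lift.

Def-free, route-independent helper (`--supports stmt-ValiantsHypothesis-18332`); nothing here is a named fact.
Honest label: an exact reformulation (VH-free) of descent in a degree window; S1c, Stub 2, the aside and VP ≠ VNP
are NOT moved.

References: Dawar–Pago–Seppelt 2025 (arXiv:2502.06740) Thm 1.1, Remark p. 17, §7 p. 45; Dwivedi–Pago–Seppelt 2026
(arXiv:2601.09343) eq. (1), Lemma 8.18.
-/

noncomputable section

open scoped Classical

-- `Summit.ValiantsHypothesis.ValiantsHypothesis.…` is the tree's single-conjunct layout (Sub = Summit).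
set_option linter.dupNamespace false

namespace Summit.ValiantsHypothesis.ValiantsHypothesis.Theorems

namespace DescentWindow

open Literature.Computability.AlgebraicComplexity MvPolynomial
open Literature.Combinatorics.SimpleGraph (treewidth)

/-! ### Graded lifting of a bipartite expansion -/

/-- **Graded lift.**  A polynomial in the bipartite narrow span of width `w` at level `n` is, DEGREE BY DEGREE,
the block restriction of a matrix-symmetric polynomial in the bipartite narrow span of width `w` at level `n + n`:
there is `P` with, for every `k`, `(P)_k` matrix-symmetric, `(P)_k ∈ W_w(n+n)` and `φ((P)_k) = (p)_k`
(`(·)_k` = homogeneous component; generator by generator `hom_{E,n} = φ(N_E⁻¹ • hom_{E,n+n})` with `N_E ≥ 1`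
admissible block colourings, `BlockDescent.aeval_block_homPoly`, and `hom` is homogeneous of degree `|E|`).
[folklore] -/
theorem exists_graded_lift {n w : ℕ}
    (φ : Fin (n + n) × Fin (n + n) → MvPolynomial (Fin n × Fin n) ℂ)
    (hφ : ∀ i j : Fin n, φ (finSumFinEquiv (Sum.inl i), finSumFinEquiv (Sum.inr j)) = X (i, j) ∧
      φ (finSumFinEquiv (Sum.inl i), finSumFinEquiv (Sum.inl j)) = 0 ∧
      φ (finSumFinEquiv (Sum.inr i), finSumFinEquiv (Sum.inl j)) = 0 ∧
      φ (finSumFinEquiv (Sum.inr i), finSumFinEquiv (Sum.inr j)) = 0)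
    (p : MvPolynomial (Fin n × Fin n) ℂ)
    (hp : p ∈ Submodule.span ℂ {q : MvPolynomial (Fin n × Fin n) ℂ | ∃ (a b : ℕ) (F : Multiset (Fin a × Fin b)),
      treewidth (SimpleGraph.fromRel fun u v : Fin a ⊕ Fin b =>
          ∃ e ∈ F, u = Sum.inl e.1 ∧ v = Sum.inr e.2) ≤ w ∧ q = homPoly F n ℂ}) :
    ∃ P : MvPolynomial (Fin (n + n) × Fin (n + n)) ℂ, ∀ k : ℕ,
      (∀ σ τ : Equiv.Perm (Fin (n + n)),
        rename (fun ij : Fin (n + n) × Fin (n + n) => (σ ij.1, τ ij.2)) (homogeneousComponent k P) =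
          homogeneousComponent k P) ∧
      homogeneousComponent k P ∈ Submodule.span ℂ {q : MvPolynomial (Fin (n + n) × Fin (n + n)) ℂ |
        ∃ (a b : ℕ) (F : Multiset (Fin a × Fin b)),
          treewidth (SimpleGraph.fromRel fun u v : Fin a ⊕ Fin b =>
            ∃ e ∈ F, u = Sum.inl e.1 ∧ v = Sum.inr e.2) ≤ w ∧ q = homPoly F (n + n) ℂ} ∧
      aeval φ (homogeneousComponent k P) = homogeneousComponent k p := by
  induction hp using Submodule.span_induction with
  | mem q hq =>
    obtain ⟨a, b, E, hE, rfl⟩ := hq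
    set N : ℕ := (Finset.univ.filter fun c : Fin (a + b) → Bool =>
        ∀ e ∈ E, c (finSumFinEquiv (Sum.inl e.1)) = false ∧
          c (finSumFinEquiv (Sum.inr e.2)) = true).card with hN
    have hNpos : (N : ℂ) ≠ 0 := by
      refine Nat.cast_ne_zero.2 (Finset.card_ne_zero.2
        ⟨fun u => Sum.elim (fun _ => false) (fun _ => true) (finSumFinEquiv.symm u),
          Finset.mem_filter.2 ⟨Finset.mem_univ _, fun e _ => ?_⟩⟩)
      simp only [Equiv.symm_apply_apply, Sum.elim_inl, Sum.elim_inr, and_self]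
    refine ⟨(N : ℂ)⁻¹ • homPoly E (n + n) ℂ, fun k => ?_⟩
    have hup : homogeneousComponent k (homPoly E (n + n) ℂ) =
        if k = Multiset.card E then homPoly E (n + n) ℂ else 0 :=
      homogeneousComponent_of_mem ((mem_homogeneousSubmodule _ _).2
        (HomPolyBasics.isHomogeneous_homPoly (K := ℂ) E (n + n)))
    have hdown : homogeneousComponent k (homPoly E n ℂ) =
        if k = Multiset.card E then homPoly E n ℂ else 0 :=
      homogeneousComponent_of_mem ((mem_homogeneousSubmodule _ _).2
        (HomPolyBasics.isHomogeneous_homPoly (K := ℂ) E n))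
    rw [map_smul, hup, hdown]
    split_ifs with hk
    · refine ⟨fun σ τ => by rw [map_smul, rename_perm_homPoly],
        Submodule.smul_mem _ _ (Submodule.subset_span ⟨a, b, E, hE, rfl⟩), ?_⟩
      rw [map_smul, BlockDescent.aeval_block_homPoly φ hφ E, ← hN, smul_smul, inv_mul_cancel₀ hNpos, one_smul]
    · rw [smul_zero]
      exact ⟨fun σ τ => by rw [map_zero], Submodule.zero_mem _, by rw [map_zero]⟩
  | zero =>
    refine ⟨0, fun k => ?_⟩
    rw [map_zero, map_zero]
    exact ⟨fun σ τ => by rw [map_zero], Submodule.zero_mem _, by rw [map_zero]⟩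
  | add x y _ _ hx hy =>
    obtain ⟨P, hP⟩ := hx
    obtain ⟨Q, hQ⟩ := hy
    refine ⟨P + Q, fun k => ?_⟩
    obtain ⟨hPs, hPm, hPx⟩ := hP k
    obtain ⟨hQs, hQm, hQy⟩ := hQ k
    rw [map_add, map_add]
    exact ⟨fun σ τ => by rw [map_add, hPs, hQs], Submodule.add_mem _ hPm hQm,
      by rw [map_add, hPx, hQy]⟩
  | smul r x _ hx =>
    obtain ⟨P, hP⟩ := hx
    refine ⟨r • P, fun k => ?_⟩
    obtain ⟨hPs, hPm, hPx⟩ := hP k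
    rw [map_smul, map_smul]
    exact ⟨fun σ τ => by rw [map_smul, hPs], Submodule.smul_mem _ r hPm, by rw [map_smul, hPx]⟩

/-- **Degree-preserving lift.**  A polynomial `p` in the bipartite narrow span of width `w` at level `n` is the
block restriction of a MATRIX-symmetric `P` in the bipartite narrow span of width `w` at level `n + n` with
`deg P ≤ deg p` (truncate the graded lift at `deg p`). [folklore] -/
theorem exists_lowDegree_lift {n w : ℕ}
    (φ : Fin (n + n) × Fin (n + n) → MvPolynomial (Fin n × Fin n) ℂ)
    (hφ : ∀ i j : Fin n, φ (finSumFinEquiv (Sum.inl i), finSumFinEquiv (Sum.inr j)) = X (i, j) ∧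
      φ (finSumFinEquiv (Sum.inl i), finSumFinEquiv (Sum.inl j)) = 0 ∧
      φ (finSumFinEquiv (Sum.inr i), finSumFinEquiv (Sum.inl j)) = 0 ∧
      φ (finSumFinEquiv (Sum.inr i), finSumFinEquiv (Sum.inr j)) = 0)
    (p : MvPolynomial (Fin n × Fin n) ℂ)
    (hp : p ∈ Submodule.span ℂ {q : MvPolynomial (Fin n × Fin n) ℂ | ∃ (a b : ℕ) (F : Multiset (Fin a × Fin b)),
      treewidth (SimpleGraph.fromRel fun u v : Fin a ⊕ Fin b =>
          ∃ e ∈ F, u = Sum.inl e.1 ∧ v = Sum.inr e.2) ≤ w ∧ q = homPoly F n ℂ}) :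
    ∃ P : MvPolynomial (Fin (n + n) × Fin (n + n)) ℂ,
      (∀ σ τ : Equiv.Perm (Fin (n + n)),
        rename (fun ij : Fin (n + n) × Fin (n + n) => (σ ij.1, τ ij.2)) P = P) ∧
      P.totalDegree ≤ p.totalDegree ∧
      P ∈ Submodule.span ℂ {q : MvPolynomial (Fin (n + n) × Fin (n + n)) ℂ |
        ∃ (a b : ℕ) (F : Multiset (Fin a × Fin b)),
          treewidth (SimpleGraph.fromRel fun u v : Fin a ⊕ Fin b =>
            ∃ e ∈ F, u = Sum.inl e.1 ∧ v = Sum.inr e.2) ≤ w ∧ q = homPoly F (n + n) ℂ} ∧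
      aeval φ P = p := by
  obtain ⟨P₀, hP₀⟩ := exists_graded_lift φ hφ p hp
  refine ⟨∑ k ∈ Finset.range (p.totalDegree + 1), homogeneousComponent k P₀, fun σ τ => ?_, ?_, ?_, ?_⟩
  · rw [map_sum]
    exact Finset.sum_congr rfl fun k _ => (hP₀ k).1 σ τ
  · refine (totalDegree_finsetSum _ _).trans (Finset.sup_le fun k hk => ?_)
    exact ((homogeneousComponent_isHomogeneous k P₀).totalDegree_le).trans
      (Nat.lt_succ_iff.1 (Finset.mem_range.1 hk))
  · exact Submodule.sum_mem _ fun k _ => (hP₀ k).2.1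
  · rw [map_sum, Finset.sum_congr rfl fun k _ => (hP₀ k).2.2]
    exact sum_homogeneousComponent p

/-! ### Reading a low-degree lift -/

/-- **A low-degree matrix-symmetric one-sortedly narrow lift descends.**  If `P` at level `n + n` is
matrix-symmetric, lies in the ONE-SORTED narrow span of width `w` and has `2 · deg P ≤ n + n`, then its block
restriction `φ(P)` lies in the BIPARTITE narrow span of width `w` at level `n` (sub-threshold descent at level
`n + n`, p827466, then block descent, p829907).  No hypothesis on `φ(P)` itself. [folklore] -/
theorem mem_narrowSpan_of_lowDegree_lift {n w : ℕ}
    (φ : Fin (n + n) × Fin (n + n) → MvPolynomial (Fin n × Fin n) ℂ)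
    (hφ : ∀ i j : Fin n, φ (finSumFinEquiv (Sum.inl i), finSumFinEquiv (Sum.inr j)) = X (i, j) ∧
      φ (finSumFinEquiv (Sum.inl i), finSumFinEquiv (Sum.inl j)) = 0 ∧
      φ (finSumFinEquiv (Sum.inr i), finSumFinEquiv (Sum.inl j)) = 0 ∧
      φ (finSumFinEquiv (Sum.inr i), finSumFinEquiv (Sum.inr j)) = 0)
    (P : MvPolynomial (Fin (n + n) × Fin (n + n)) ℂ)
    (hPs : ∀ σ τ : Equiv.Perm (Fin (n + n)),
      rename (fun ij : Fin (n + n) × Fin (n + n) => (σ ij.1, τ ij.2)) P = P)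
    (hPdeg : 2 * P.totalDegree ≤ n + n)
    (hPU : P ∈ Submodule.span ℂ {q : MvPolynomial (Fin (n + n) × Fin (n + n)) ℂ |
      ∃ (a : ℕ) (D : Multiset (Fin a × Fin a)),
        treewidth (SimpleGraph.fromRel fun u v : Fin a => ∃ e ∈ D, u = e.1 ∧ v = e.2) ≤ w ∧
          q = diHomPoly D (n + n) ℂ}) :
    aeval φ P ∈ Submodule.span ℂ {q : MvPolynomial (Fin n × Fin n) ℂ | ∃ (a b : ℕ) (F : Multiset (Fin a × Fin b)),
      treewidth (SimpleGraph.fromRel fun u v : Fin a ⊕ Fin b =>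
          ∃ e ∈ F, u = Sum.inl e.1 ∧ v = Sum.inr e.2) ≤ w ∧ q = homPoly F n ℂ} :=
  BlockDescent.block_descent_span φ hφ w P (SubThresholdDescent.narrowSpan_le_diNarrowSpan _ _
    (SubThresholdDescent.subThreshold_descent (n + n) w P hPs hPdeg hPU))

/-! ### The window theorem -/

/-- ★ **THE DEGREE WINDOW `deg p ≤ n`: BIPARTITE NARROWNESS = LOW-DEGREE MATRIX-SYMMETRIC ONE-SORTED LIFTABILITY,
SAME WIDTH.**  For every polynomial `p` on the `n × n` matrix with `deg p ≤ n` (in particular throughout the first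
window `n/2 < deg p ≤ n` above the injective threshold, where same-level descent is open) and every width `w`:
`p ∈ span{hom_{F,n} : tw F ≤ w}` if and only if `p = φ(P)` for a MATRIX-symmetric `P` on the `(n+n) × (n+n)`
matrix with `deg P ≤ n` lying in `span{dihom_{D,n+n} : tw D ≤ w}`. [folklore] -/
theorem mem_narrowSpan_iff_lowDegree_lift {n w : ℕ}
    (φ : Fin (n + n) × Fin (n + n) → MvPolynomial (Fin n × Fin n) ℂ)
    (hφ : ∀ i j : Fin n, φ (finSumFinEquiv (Sum.inl i), finSumFinEquiv (Sum.inr j)) = X (i, j) ∧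
      φ (finSumFinEquiv (Sum.inl i), finSumFinEquiv (Sum.inl j)) = 0 ∧
      φ (finSumFinEquiv (Sum.inr i), finSumFinEquiv (Sum.inl j)) = 0 ∧
      φ (finSumFinEquiv (Sum.inr i), finSumFinEquiv (Sum.inr j)) = 0)
    (p : MvPolynomial (Fin n × Fin n) ℂ) (hdeg : p.totalDegree ≤ n) :
    p ∈ Submodule.span ℂ {q : MvPolynomial (Fin n × Fin n) ℂ | ∃ (a b : ℕ) (F : Multiset (Fin a × Fin b)),
      treewidth (SimpleGraph.fromRel fun u v : Fin a ⊕ Fin b =>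
          ∃ e ∈ F, u = Sum.inl e.1 ∧ v = Sum.inr e.2) ≤ w ∧ q = homPoly F n ℂ} ↔
    ∃ P : MvPolynomial (Fin (n + n) × Fin (n + n)) ℂ,
      (∀ σ τ : Equiv.Perm (Fin (n + n)),
        rename (fun ij : Fin (n + n) × Fin (n + n) => (σ ij.1, τ ij.2)) P = P) ∧
      P.totalDegree ≤ n ∧
      P ∈ Submodule.span ℂ {q : MvPolynomial (Fin (n + n) × Fin (n + n)) ℂ |
        ∃ (a : ℕ) (D : Multiset (Fin a × Fin a)),
          treewidth (SimpleGraph.fromRel fun u v : Fin a => ∃ e ∈ D, u = e.1 ∧ v = e.2) ≤ w ∧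
            q = diHomPoly D (n + n) ℂ} ∧
      aeval φ P = p := by
  constructor
  · intro hp
    obtain ⟨P, hPs, hPd, hPm, hPp⟩ := exists_lowDegree_lift φ hφ p hp
    exact ⟨P, hPs, hPd.trans hdeg, SubThresholdDescent.narrowSpan_le_diNarrowSpan _ _ hPm, hPp⟩
  · rintro ⟨P, hPs, hPd, hPU, rfl⟩
    exact mem_narrowSpan_of_lowDegree_lift φ hφ P hPs (by omega) hPU

/-- ★ **DESCENT IN THE WINDOW ⟺ LIFTING.**  For widths `w, w'` and a level `n`: every MATRIX-symmetric `p` with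
`deg p ≤ n` in the one-sorted narrow span of width `w` lies in the bipartite narrow span of width `w'` (descent on
the window `deg ≤ n`, open for `deg > n/2` when `w' = w + O(1)`) IF AND ONLY IF every such `p` has a matrix-symmetric
lift `P`, `deg P ≤ n`, in the one-sorted narrow span of width `w'` at level `n + n` with `φ(P) = p`. [folklore] -/
theorem descentWindow_iff_lift {n w w' : ℕ}
    (φ : Fin (n + n) × Fin (n + n) → MvPolynomial (Fin n × Fin n) ℂ)
    (hφ : ∀ i j : Fin n, φ (finSumFinEquiv (Sum.inl i), finSumFinEquiv (Sum.inr j)) = X (i, j) ∧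
      φ (finSumFinEquiv (Sum.inl i), finSumFinEquiv (Sum.inl j)) = 0 ∧
      φ (finSumFinEquiv (Sum.inr i), finSumFinEquiv (Sum.inl j)) = 0 ∧
      φ (finSumFinEquiv (Sum.inr i), finSumFinEquiv (Sum.inr j)) = 0) :
    (∀ p : MvPolynomial (Fin n × Fin n) ℂ,
      (∀ σ τ : Equiv.Perm (Fin n), rename (fun ij : Fin n × Fin n => (σ ij.1, τ ij.2)) p = p) →
      p.totalDegree ≤ n →
      p ∈ Submodule.span ℂ {q : MvPolynomial (Fin n × Fin n) ℂ |
        ∃ (a : ℕ) (D : Multiset (Fin a × Fin a)),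
          treewidth (SimpleGraph.fromRel fun u v : Fin a => ∃ e ∈ D, u = e.1 ∧ v = e.2) ≤ w ∧
            q = diHomPoly D n ℂ} →
      p ∈ Submodule.span ℂ {q : MvPolynomial (Fin n × Fin n) ℂ | ∃ (a b : ℕ) (F : Multiset (Fin a × Fin b)),
        treewidth (SimpleGraph.fromRel fun u v : Fin a ⊕ Fin b =>
          ∃ e ∈ F, u = Sum.inl e.1 ∧ v = Sum.inr e.2) ≤ w' ∧ q = homPoly F n ℂ}) ↔
    (∀ p : MvPolynomial (Fin n × Fin n) ℂ,
      (∀ σ τ : Equiv.Perm (Fin n), rename (fun ij : Fin n × Fin n => (σ ij.1, τ ij.2)) p = p) →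
      p.totalDegree ≤ n →
      p ∈ Submodule.span ℂ {q : MvPolynomial (Fin n × Fin n) ℂ |
        ∃ (a : ℕ) (D : Multiset (Fin a × Fin a)),
          treewidth (SimpleGraph.fromRel fun u v : Fin a => ∃ e ∈ D, u = e.1 ∧ v = e.2) ≤ w ∧
            q = diHomPoly D n ℂ} →
      ∃ P : MvPolynomial (Fin (n + n) × Fin (n + n)) ℂ,
        (∀ σ τ : Equiv.Perm (Fin (n + n)),
          rename (fun ij : Fin (n + n) × Fin (n + n) => (σ ij.1, τ ij.2)) P = P) ∧
        P.totalDegree ≤ n ∧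
        P ∈ Submodule.span ℂ {q : MvPolynomial (Fin (n + n) × Fin (n + n)) ℂ |
          ∃ (a : ℕ) (D : Multiset (Fin a × Fin a)),
            treewidth (SimpleGraph.fromRel fun u v : Fin a => ∃ e ∈ D, u = e.1 ∧ v = e.2) ≤ w' ∧
              q = diHomPoly D (n + n) ℂ} ∧
        aeval φ P = p) :=
  ⟨fun h p hp hd hU => (mem_narrowSpan_iff_lowDegree_lift φ hφ p hd).1 (h p hp hd hU),
    fun h p hp hd hU => (mem_narrowSpan_iff_lowDegree_lift φ hφ p hd).2 (h p hp hd hU)⟩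

/-! ### Two storeys: the window `deg p ≤ 2n` -/

/-- **Two-storey towers.**  If `P₂` at level `(n+n)+(n+n)` is matrix-symmetric, one-sortedly narrow of width `w`
and has `2 · deg P₂ ≤ 4n`, then `φ₁(φ₂(P₂))` at level `n` is bipartitely narrow of width `w` — the degree bound is
needed at the TOP storey only (block descent brings bipartite narrowness down unconditionally).  So every `p` with
`deg p ≤ 2n` obtained this way is in `W_w(n)`; conversely every `p ∈ W_w(n)` has such a tower with `deg ≤ deg p`
(`exists_lowDegree_lift` twice). [folklore] -/
theorem mem_narrowSpan_of_lift_tower₂ {n w : ℕ}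
    (φ₁ : Fin (n + n) × Fin (n + n) → MvPolynomial (Fin n × Fin n) ℂ)
    (hφ₁ : ∀ i j : Fin n, φ₁ (finSumFinEquiv (Sum.inl i), finSumFinEquiv (Sum.inr j)) = X (i, j) ∧
      φ₁ (finSumFinEquiv (Sum.inl i), finSumFinEquiv (Sum.inl j)) = 0 ∧
      φ₁ (finSumFinEquiv (Sum.inr i), finSumFinEquiv (Sum.inl j)) = 0 ∧
      φ₁ (finSumFinEquiv (Sum.inr i), finSumFinEquiv (Sum.inr j)) = 0)
    (φ₂ : Fin ((n + n) + (n + n)) × Fin ((n + n) + (n + n)) → MvPolynomial (Fin (n + n) × Fin (n + n)) ℂ)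
    (hφ₂ : ∀ i j : Fin (n + n), φ₂ (finSumFinEquiv (Sum.inl i), finSumFinEquiv (Sum.inr j)) = X (i, j) ∧
      φ₂ (finSumFinEquiv (Sum.inl i), finSumFinEquiv (Sum.inl j)) = 0 ∧
      φ₂ (finSumFinEquiv (Sum.inr i), finSumFinEquiv (Sum.inl j)) = 0 ∧
      φ₂ (finSumFinEquiv (Sum.inr i), finSumFinEquiv (Sum.inr j)) = 0)
    (P₂ : MvPolynomial (Fin ((n + n) + (n + n)) × Fin ((n + n) + (n + n))) ℂ)
    (hPs : ∀ σ τ : Equiv.Perm (Fin ((n + n) + (n + n))),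
      rename (fun ij : Fin ((n + n) + (n + n)) × Fin ((n + n) + (n + n)) => (σ ij.1, τ ij.2)) P₂ = P₂)
    (hPdeg : 2 * P₂.totalDegree ≤ (n + n) + (n + n))
    (hPU : P₂ ∈ Submodule.span ℂ {q : MvPolynomial (Fin ((n + n) + (n + n)) × Fin ((n + n) + (n + n))) ℂ |
      ∃ (a : ℕ) (D : Multiset (Fin a × Fin a)),
        treewidth (SimpleGraph.fromRel fun u v : Fin a => ∃ e ∈ D, u = e.1 ∧ v = e.2) ≤ w ∧
          q = diHomPoly D ((n + n) + (n + n)) ℂ}) :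
    aeval φ₁ (aeval φ₂ P₂) ∈ Submodule.span ℂ {q : MvPolynomial (Fin n × Fin n) ℂ |
      ∃ (a b : ℕ) (F : Multiset (Fin a × Fin b)),
        treewidth (SimpleGraph.fromRel fun u v : Fin a ⊕ Fin b =>
          ∃ e ∈ F, u = Sum.inl e.1 ∧ v = Sum.inr e.2) ≤ w ∧ q = homPoly F n ℂ} :=
  BlockDescent.block_descent_span φ₁ hφ₁ w _ (SubThresholdDescent.narrowSpan_le_diNarrowSpan _ _
    (mem_narrowSpan_of_lowDegree_lift φ₂ hφ₂ P₂ hPs hPdeg hPU))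

/-- **… and every bipartitely narrow `p` has a two-storey tower of matrix-symmetric bipartitely (hence one-sortedly)
narrow lifts with `deg ≤ deg p`.** [folklore] -/
theorem exists_lift_tower₂ {n w : ℕ}
    (φ₁ : Fin (n + n) × Fin (n + n) → MvPolynomial (Fin n × Fin n) ℂ)
    (hφ₁ : ∀ i j : Fin n, φ₁ (finSumFinEquiv (Sum.inl i), finSumFinEquiv (Sum.inr j)) = X (i, j) ∧
      φ₁ (finSumFinEquiv (Sum.inl i), finSumFinEquiv (Sum.inl j)) = 0 ∧
      φ₁ (finSumFinEquiv (Sum.inr i), finSumFinEquiv (Sum.inl j)) = 0 ∧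
      φ₁ (finSumFinEquiv (Sum.inr i), finSumFinEquiv (Sum.inr j)) = 0)
    (φ₂ : Fin ((n + n) + (n + n)) × Fin ((n + n) + (n + n)) → MvPolynomial (Fin (n + n) × Fin (n + n)) ℂ)
    (hφ₂ : ∀ i j : Fin (n + n), φ₂ (finSumFinEquiv (Sum.inl i), finSumFinEquiv (Sum.inr j)) = X (i, j) ∧
      φ₂ (finSumFinEquiv (Sum.inl i), finSumFinEquiv (Sum.inl j)) = 0 ∧
      φ₂ (finSumFinEquiv (Sum.inr i), finSumFinEquiv (Sum.inl j)) = 0 ∧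
      φ₂ (finSumFinEquiv (Sum.inr i), finSumFinEquiv (Sum.inr j)) = 0)
    (p : MvPolynomial (Fin n × Fin n) ℂ)
    (hp : p ∈ Submodule.span ℂ {q : MvPolynomial (Fin n × Fin n) ℂ | ∃ (a b : ℕ) (F : Multiset (Fin a × Fin b)),
      treewidth (SimpleGraph.fromRel fun u v : Fin a ⊕ Fin b =>
          ∃ e ∈ F, u = Sum.inl e.1 ∧ v = Sum.inr e.2) ≤ w ∧ q = homPoly F n ℂ}) :
    ∃ P₂ : MvPolynomial (Fin ((n + n) + (n + n)) × Fin ((n + n) + (n + n))) ℂ,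
      (∀ σ τ : Equiv.Perm (Fin ((n + n) + (n + n))),
        rename (fun ij : Fin ((n + n) + (n + n)) × Fin ((n + n) + (n + n)) => (σ ij.1, τ ij.2)) P₂ = P₂) ∧
      P₂.totalDegree ≤ p.totalDegree ∧
      P₂ ∈ Submodule.span ℂ {q : MvPolynomial (Fin ((n + n) + (n + n)) × Fin ((n + n) + (n + n))) ℂ |
        ∃ (a : ℕ) (D : Multiset (Fin a × Fin a)),
          treewidth (SimpleGraph.fromRel fun u v : Fin a => ∃ e ∈ D, u = e.1 ∧ v = e.2) ≤ w ∧
            q = diHomPoly D ((n + n) + (n + n)) ℂ} ∧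
      aeval φ₁ (aeval φ₂ P₂) = p := by
  obtain ⟨P₁, -, hd₁, hm₁, hp₁⟩ := exists_lowDegree_lift φ₁ hφ₁ p hp
  obtain ⟨P₂, hs₂, hd₂, hm₂, hp₂⟩ := exists_lowDegree_lift φ₂ hφ₂ P₁ hm₁
  exact ⟨P₂, hs₂, hd₂.trans hd₁, SubThresholdDescent.narrowSpan_le_diNarrowSpan _ _ hm₂,
    by rw [hp₂, hp₁]⟩

end DescentWindow

end Summit.ValiantsHypothesis.ValiantsHypothesis.Theorems

end
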